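import Literature.NumberTheory.EllipticCurves.IwasawaAlgebraRankOneIdealProofs
import Literature.NumberTheory.EllipticCurves.IwasawaSelmerIsTorsionProofs
import Mathlib.RingTheory.Spectrum.Prime.RingHom
import Mathlib.RingTheory.Ideal.Height
import Mathlib.RingTheory.Ideal.Quotient.Operations
import Mathlib.LinearAlgebra.Dimension.Torsion.Finite
import Mathlib.LinearAlgebra.Dimension.RankNullity
import HarnessLib

/-!
# Transport of local lengths and characteristic ideals along SEMILINEAR equivalences
# (`char(M^σ) = σ(char M)`), twisted cyclic quotients, and torsion bookkeeping in short exact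
# sequences (module theory; THEOREMS ONLY)

`Proofs`-style sequel of `IwasawaAlgebra.lean` / `IwasawaAlgebraProofs.lean` /
`IwasawaAlgebraCharIdealProofs.lean` / `IwasawaAlgebraRankOneIdealProofs.lean` (the tree's
`Literature.NumberTheory.EllipticCurves.Module.lengthAt`, `….Module.charIdeal`) and of
`IwasawaAlgebraInvolution.lean` (whose docstring lists as TODO "transport of `Module.charIdeal` /
`lengthAt` along `ι`-semilinear equivalences (`Char(M^ι) = ι(Char M)`)"). THEOREMS ONLY (no
definition, no named fact, no instance, no `sorry`); Mathlib-style commutative algebra over an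
arbitrary commutative ring (resp. Noetherian domain), nothing about elliptic curves is asserted.
Written for the BSD summit's cell `pub/bsd-wall` (seat `bsd-wall-utd-ty1` g5): these are the module-
theoretic steps of Castella–Wan's proof of their Thm. 6.8 ((6.14)–(6.16), *Perrin-Riou's main
conjecture for elliptic curves at supersingular primes*, Math. Ann. 389 (2024), MS pp. 30–31), in
which the connecting maps of global duality are `ι`-semilinear for the tree's conventions (flag
`dual-convention` of `AnticyclotomicSignedTransferInputs.lean`).

## What is proved

* §1 `Module.lengthAt_eq_of_semilinearEquiv` — for a ring isomorphism `σ : R ≃+* S`, an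
  `R`-module `M`, an `S`-module `N` and an additive equivalence `e : M ≃+ N` with
  `e (r • m) = σ r • e m`, the local length of `M` at a prime `𝔭` equals the local length of `N` at
  `σ(𝔭)` (`PrimeSpectrum.comapEquiv σ 𝔭`): `σ` localises to `R_𝔭 ≃+* S_{σ𝔭}`
  (`IsLocalization.ringEquivOfRingEquiv`), `e` to a bijection `M_𝔭 → N_{σ𝔭}` semilinear over it,
  and a semilinear bijection over a surjective ring map induces an isomorphism of submodule lattices
  (`Submodule.orderIsoMapComapOfBijective`), hence equal lengths (Krull dimensions of the lattices).
* §1 `Module.charIdeal_eq_map_of_semilinearEquiv` — **`char_S(N) = σ(char_R(M))`** in the same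
  situation (`char = ∏_{ht 𝔭 = 1} 𝔭^{length}`; `σ` permutes the height-one primes,
  `RingEquiv.height_comap`); `Module.charIdeal_quotient_map_ringEquiv` — the twisted cyclic
  quotient `char(R ⧸ σ(I)) = σ(char(R ⧸ I))`.
* §2 torsion bookkeeping over a Noetherian domain `R` for a surjection `g : B ↠ C` of finitely
  generated modules whose kernel is torsion: `Module.isTorsion_of_surjective_of_ker`
  (`C` torsion ⟹ `B` torsion), `Module.finrank_eq_of_surjective_of_ker_isTorsion`
  (`rank B = rank C`), `Module.torsion_map_surjective_of_ker` (`B_tors ↠ C_tors`),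
  `Module.charIdeal_torsion_eq_mul_of_surjective` (**`char(B_tors) = char(ker g) · char(C_tors)`**),
  `Module.charIdeal_eq_mul_of_surjective` (`char B = char(ker g) · char C` for `B` torsion),
  `Module.charIdeal_torsion_eq_of_isTorsion` (`char(M_tors) = char(M)` for torsion `M`),
  `Module.isTorsion_quotient_of_ne_zero_mem` (`R ⧸ I` is torsion if `I ∋ a ≠ 0`),
  `Module.isTorsion_and_charIdeal_eq_of_surjective_pair` (the two-surjection chain of (6.15)–(6.16):
  `char C = char(ker r) · char(ker r') · char(B_tors)`),
  `Module.charIdeal_quotient_mono` (`char(M ⧸ P) ⊆ char(M ⧸ Q)` for `P ≤ Q`, torsion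
  quotients), `Module.charIdeal_quotient_mul_charIdeal_quotient_map` (`char(Q ⧸ P) · char(M ⧸ Q)
  = char(M ⧸ P)` written with `Q.map P.mkQ`).

## References

* N. Bourbaki, *Algèbre commutative*, Ch. VII §4.4–4.5 (local lengths at height-one primes,
  Prop. 10: multiplicativity of the characteristic ideal). [BourbakiAC5to7]
* L. C. Washington, *Introduction to Cyclotomic Fields*, GTM 83, §13.2 (characteristic ideals of
  `Λ`-modules; the involution `γ ↦ γ⁻¹`). [Washington1997]
* R. Greenberg, LNM 1716 (1999), §1 p. 60 (the two `Λ`-module structures on a Pontryagin dual differ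
  by the involution). [GreenbergLNM1716]
* F. Castella, X. Wan, Math. Ann. 389 (2024), proof of Thm. 6.8, (6.14)–(6.16) (MS pp. 30–31: the
  short exact sequences whose characteristic ideals are multiplied). [CastellaWan2023]
-/

noncomputable section

open scoped Classical

namespace Literature.NumberTheory.EllipticCurves

namespace Module

/-! ## §1 Semilinear transport of local lengths and characteristic ideals -/

section Semilinear

variable {R : Type*} {S : Type*} [CommRing R] [CommRing S] (σ : R ≃+* S)
  {M : Type*} [AddCommGroup M] [_root_.Module R M]
  {N : Type*} [AddCommGroup N] [_root_.Module S N]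

/-- Membership in the prime `σ(𝔭)` (`PrimeSpectrum.comapEquiv σ 𝔭`, i.e. `𝔭.comap σ⁻¹`):
`σ r ∈ σ(𝔭) ↔ r ∈ 𝔭`. [folklore] -/
private theorem apply_mem_comapEquiv_asIdeal_iff (𝔭 : PrimeSpectrum R) (r : R) :
    σ r ∈ (PrimeSpectrum.comapEquiv σ 𝔭).asIdeal ↔ r ∈ 𝔭.asIdeal := by
  rw [PrimeSpectrum.comapEquiv_apply, PrimeSpectrum.comap_asIdeal, Ideal.mem_comap]
  change σ.symm (σ r) ∈ 𝔭.asIdeal ↔ r ∈ 𝔭.asIdeal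
  rw [RingEquiv.symm_apply_apply]

/-- Membership in the prime `σ(𝔭)`: `s ∈ σ(𝔭) ↔ σ⁻¹ s ∈ 𝔭`. [folklore] -/
private theorem mem_comapEquiv_asIdeal_iff (𝔭 : PrimeSpectrum R) (s : S) :
    s ∈ (PrimeSpectrum.comapEquiv σ 𝔭).asIdeal ↔ σ.symm s ∈ 𝔭.asIdeal := by
  rw [← apply_mem_comapEquiv_asIdeal_iff σ 𝔭 (σ.symm s), RingEquiv.apply_symm_apply]

/-- The prime `σ(𝔭)` is the image ideal `𝔭.map σ`. [folklore] -/
private theorem comapEquiv_asIdeal_eq_map (𝔭 : PrimeSpectrum R) :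
    (PrimeSpectrum.comapEquiv σ 𝔭).asIdeal = 𝔭.asIdeal.map (σ : R →+* S) := by
  rw [Ideal.map_comap_of_equiv, PrimeSpectrum.comapEquiv_apply, PrimeSpectrum.comap_asIdeal]
  rfl

/-- `σ` maps the complement of `𝔭` onto the complement of `σ(𝔭)`. [folklore] -/
private theorem map_primeCompl_eq_primeCompl_comapEquiv (𝔭 : PrimeSpectrum R) :
    𝔭.asIdeal.primeCompl.map σ.toMonoidHom = (PrimeSpectrum.comapEquiv σ 𝔭).asIdeal.primeCompl := by
  ext t
  rw [Submonoid.mem_map]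
  constructor
  · rintro ⟨s, hs, rfl⟩
    intro ht
    exact hs ((apply_mem_comapEquiv_asIdeal_iff σ 𝔭 s).1 ht)
  · intro ht
    refine ⟨σ.symm t, fun h ↦ ht ((mem_comapEquiv_asIdeal_iff σ 𝔭 t).2 h), ?_⟩
    exact σ.apply_symm_apply t

/-- A ring isomorphism preserves heights of primes: `ht σ(𝔭) = ht 𝔭`. [folklore] -/
private theorem height_comapEquiv_asIdeal (𝔭 : PrimeSpectrum R) :
    (PrimeSpectrum.comapEquiv σ 𝔭).asIdeal.height = 𝔭.asIdeal.height := by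
  rw [PrimeSpectrum.comapEquiv_apply, PrimeSpectrum.comap_asIdeal]
  exact RingEquiv.height_comap σ.symm 𝔭.asIdeal

/-- **Local lengths are invariant under semilinear equivalences.** Let `σ : R ≃+* S` be a ring
isomorphism, `M` an `R`-module, `N` an `S`-module and `e : M ≃+ N` additive with
`e (r • m) = σ r • e m`. Then `length_{R_𝔭}(M_𝔭) = length_{S_{σ𝔭}}(N_{σ𝔭})` for every prime `𝔭`
of `R`. Proof: `σ` induces `R_𝔭 ≃+* S_{σ𝔭}` (`IsLocalization.ringEquivOfRingEquiv`), `e` induces a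
bijection `M_𝔭 → N_{σ𝔭}`, `m/s ↦ e(m)/σ(s)`, semilinear over it, and a semilinear bijection over a
surjective ring homomorphism identifies the submodule lattices
(`Submodule.orderIsoMapComapOfBijective`), whose Krull dimensions are the lengths. (Bourbaki AC VII
§4.4: the local length is an invariant of the module up to semilinear isomorphism — transport of
structure.) [cite: BourbakiAC5to7, Ch. VII §4.4] -/
theorem lengthAt_eq_of_semilinearEquiv (e : M ≃+ N) (he : ∀ (r : R) (m : M), e (r • m) = σ r • e m)
    (𝔭 : PrimeSpectrum R) :
    lengthAt R M 𝔭 = lengthAt S N (PrimeSpectrum.comapEquiv σ 𝔭) := by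
  set 𝔮 := PrimeSpectrum.comapEquiv σ 𝔭 with h𝔮
  set P := 𝔭.asIdeal.primeCompl with hP
  set Q := 𝔮.asIdeal.primeCompl with hQ
  have hPQ : ∀ s : P, (σ s : S) ∈ Q := fun s h ↦ s.2 ((apply_mem_comapEquiv_asIdeal_iff σ 𝔭 s).1 h)
  have hQP : ∀ t : Q, σ.symm t ∈ P := fun t h ↦ t.2 ((mem_comapEquiv_asIdeal_iff σ 𝔭 t).2 h)
  have H : P.map σ.toMonoidHom = Q := map_primeCompl_eq_primeCompl_comapEquiv σ 𝔭
  let Rp := Localization.AtPrime 𝔭.asIdeal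
  let Sq := Localization.AtPrime 𝔮.asIdeal
  let τ : Rp ≃+* Sq := IsLocalization.ringEquivOfRingEquiv Rp Sq σ H
  have hτ : ∀ (r : R) (s : P), τ (Localization.mk r s) = Localization.mk (σ r) ⟨σ s, hPQ s⟩ := by
    intro r s
    rw [Localization.mk_eq_mk'_apply, IsLocalization.ringEquivOfRingEquiv_mk',
      Localization.mk_eq_mk'_apply]
  -- the map on localised modules, `m/s ↦ e(m)/σ(s)`
  let g : LocalizedModule P M → LocalizedModule Q N := fun x ↦
    x.liftOn (fun ms ↦ LocalizedModule.mk (e ms.1) ⟨σ ms.2, hPQ ms.2⟩) (by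
      rintro ⟨m, s⟩ ⟨m', s'⟩ ⟨u, hu⟩
      refine LocalizedModule.mk_eq.mpr ⟨⟨σ u, hPQ u⟩, ?_⟩
      have hu' := congrArg e hu
      simp only [Submonoid.smul_def, he] at hu' ⊢
      exact hu')
  have hg_mk : ∀ (m : M) (s : P), g (LocalizedModule.mk m s) = LocalizedModule.mk (e m) ⟨σ s, hPQ s⟩ :=
    fun m s ↦ LocalizedModule.liftOn_mk _ m s
  have hg_add : ∀ x y, g (x + y) = g x + g y := by
    intro x y
    induction x using LocalizedModule.induction_on with | h m s => ?_
    induction y using LocalizedModule.induction_on with | h m' s' => ?_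
    rw [LocalizedModule.mk_add_mk, hg_mk, hg_mk, hg_mk, LocalizedModule.mk_add_mk]
    congr 1
    · rw [map_add, Submonoid.smul_def, Submonoid.smul_def, he, he, Submonoid.smul_def,
        Submonoid.smul_def]
    · exact Subtype.ext (map_mul σ _ _)
  have hg_smul : ∀ (x : Rp) (y : LocalizedModule P M), g (x • y) = (τ : Rp →+* Sq) x • g y := by
    intro x y
    induction x using Localization.induction_on with | H rs => ?_
    induction y using LocalizedModule.induction_on with | h m s => ?_
    rw [RingHom.coe_coe, LocalizedModule.mk_smul_mk, hg_mk, hg_mk, hτ, LocalizedModule.mk_smul_mk]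
    congr 1
    · exact he _ _
    · exact Subtype.ext (map_mul σ _ _)
  let gl : LocalizedModule P M →ₛₗ[(τ : Rp →+* Sq)] LocalizedModule Q N :=
    { toFun := g, map_add' := hg_add, map_smul' := hg_smul }
  have hg_surj : Function.Surjective g := by
    intro y
    induction y using LocalizedModule.induction_on with | h n t => ?_
    refine ⟨LocalizedModule.mk (e.symm n) ⟨σ.symm t, hQP t⟩, ?_⟩
    rw [hg_mk]
    congr 1
    · exact e.apply_symm_apply n
    · exact Subtype.ext (σ.apply_symm_apply t)
  have hg_inj : Function.Injective g := by
    intro x y hxy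
    induction x using LocalizedModule.induction_on with | h m s => ?_
    induction y using LocalizedModule.induction_on with | h m' s' => ?_
    rw [hg_mk, hg_mk, LocalizedModule.mk_eq] at hxy
    obtain ⟨u, hu⟩ := hxy
    refine LocalizedModule.mk_eq.mpr ⟨⟨σ.symm u, hQP u⟩, e.injective ?_⟩
    simp only [Submonoid.smul_def, he, RingEquiv.apply_symm_apply] at hu ⊢
    exact hu
  haveI : RingHomSurjective (τ : Rp →+* Sq) := ⟨τ.surjective⟩
  unfold lengthAt
  apply WithBot.coe_injective
  rw [_root_.Module.coe_length, _root_.Module.coe_length]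
  exact Order.krullDim_eq_of_orderIso
    (Submodule.orderIsoMapComapOfBijective gl ⟨hg_inj, hg_surj⟩)

/-- **Characteristic ideals are transported by semilinear equivalences: `char_S(N) = σ(char_R(M))`.**
For `σ : R ≃+* S`, `M` an `R`-module, `N` an `S`-module and an additive equivalence `e : M ≃+ N`
with `e (r • m) = σ r • e m`: `char_S(N) = ∏_{ht 𝔮 = 1} 𝔮^{ℓ_𝔮(N)}` is the image under `σ` of
`char_R(M) = ∏_{ht 𝔭 = 1} 𝔭^{ℓ_𝔭(M)}`, because `σ` permutes the height-one primes (`𝔭 ↦ σ(𝔭)`,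
`RingEquiv.height_comap`) and `ℓ_{σ𝔭}(N) = ℓ_𝔭(M)` (`lengthAt_eq_of_semilinearEquiv`). The case
`S = R`, `σ = ι` the Iwasawa involution, `N = M` with the twisted action is "`Char(M^ι) = ι(Char M)`"
(Greenberg, LNM 1716, §1 p. 60; Washington §13.2). [cite: BourbakiAC5to7, Ch. VII §4.5]
[cite: GreenbergLNM1716, §1 p. 60] -/
theorem charIdeal_eq_map_of_semilinearEquiv (e : M ≃+ N)
    (he : ∀ (r : R) (m : M), e (r • m) = σ r • e m) :
    charIdeal S N = (charIdeal R M).map (σ : R →+* S) := by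
  let φ : Ideal R →+* Ideal S := Ideal.mapHom (σ : R →+* S)
  have hφ : Function.Injective φ := by
    intro I J h
    have h' : (I.map (σ : R →+* S)).comap (σ : R →+* S) = (J.map (σ : R →+* S)).comap (σ : R →+* S) := by
      change (φ I).comap (σ : R →+* S) = (φ J).comap (σ : R →+* S)
      rw [h]
    rwa [Ideal.comap_map_of_bijective (σ : R →+* S) σ.bijective,
      Ideal.comap_map_of_bijective (σ : R →+* S) σ.bijective] at h'
  have hφmap : ∀ I : Ideal R, φ I = I.map (σ : R →+* S) := fun I ↦ rfl
  -- push `σ` through the (possibly infinite) product: `Ideal.map σ` is an injective monoid hom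
  have h1 : (charIdeal R M).map (σ : R →+* S) =
      ∏ᶠ 𝔭 : PrimeSpectrum R, ∏ᶠ (_ : 𝔭 ∈ {𝔭 : PrimeSpectrum R | 𝔭.asIdeal.height = 1}),
        (𝔭.asIdeal.map (σ : R →+* S)) ^ (lengthAt R M 𝔭).toNat := by
    have key : ∀ (f : PrimeSpectrum R → Ideal R), φ (∏ᶠ i, f i) = ∏ᶠ i, φ (f i) :=
      fun f ↦ (φ : Ideal R →* Ideal S).map_finprod_of_injective hφ f
    have keyP : ∀ {q : Prop} (f : q → Ideal R), φ (∏ᶠ i, f i) = ∏ᶠ i, φ (f i) :=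
      fun f ↦ (φ : Ideal R →* Ideal S).map_finprod_Prop f
    unfold charIdeal
    rw [← hφmap, key]
    refine finprod_congr fun 𝔭 ↦ ?_
    rw [keyP]
    refine finprod_congr fun _ ↦ ?_
    rw [map_pow, hφmap]
  rw [h1]
  -- reindex the product over the height-one primes of `S` along `𝔭 ↦ σ(𝔭)`
  unfold charIdeal
  rw [← finprod_comp_equiv (PrimeSpectrum.comapEquiv σ).toEquiv]
  refine finprod_congr fun 𝔭 ↦ ?_
  have hmem : ((PrimeSpectrum.comapEquiv σ).toEquiv 𝔭 ∈
      {𝔮 : PrimeSpectrum S | 𝔮.asIdeal.height = 1}) ↔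
      (𝔭 ∈ {𝔭 : PrimeSpectrum R | 𝔭.asIdeal.height = 1}) := by
    simp only [Set.mem_setOf_eq]
    rw [show (PrimeSpectrum.comapEquiv σ).toEquiv 𝔭 = PrimeSpectrum.comapEquiv σ 𝔭 from rfl,
      height_comapEquiv_asIdeal]
  rw [finprod_eq_if, finprod_eq_if]
  rw [if_congr hmem rfl rfl]
  split_ifs
  · rw [show (PrimeSpectrum.comapEquiv σ).toEquiv 𝔭 = PrimeSpectrum.comapEquiv σ 𝔭 from rfl,
      comapEquiv_asIdeal_eq_map, ← lengthAt_eq_of_semilinearEquiv σ e he 𝔭]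
  · rfl

/-- **Twisted cyclic quotients: `char(R ⧸ σ(I)) = σ(char(R ⧸ I))`** for a ring automorphism `σ`
of `R` and an ideal `I` (the quotient map `R ⧸ I → R ⧸ σ(I)` induced by `σ` is an additive
equivalence with `x ↦ σ(r) x` over `r ↦ σ r`). With `σ = ι` the Iwasawa involution this is the
computation of the characteristic ideal of a cyclic `Λ`-module met through an `ι`-semilinear map
(Castella–Wan, proof of Thm. 6.8: `coker(loc_𝔭) ⊂ X^{rel,·}`). [cite: GreenbergLNM1716, §1 p. 60]
[cite: Washington1997, §13.2] -/
theorem charIdeal_quotient_map_ringEquiv {R : Type*} [CommRing R] (σ : R ≃+* R) (I : Ideal R) :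
    charIdeal R (R ⧸ I.map (σ : R →+* R)) = (charIdeal R (R ⧸ I)).map (σ : R →+* R) := by
  set qe := Ideal.quotientEquiv I (I.map (σ : R →+* R)) σ rfl with hqe
  refine charIdeal_eq_map_of_semilinearEquiv σ qe.toAddEquiv fun r x ↦ ?_
  obtain ⟨y, rfl⟩ := Ideal.Quotient.mk_surjective x
  change qe (r • Ideal.Quotient.mk I y) = σ r • qe (Ideal.Quotient.mk I y)
  rw [Algebra.smul_def, Algebra.smul_def, Ideal.Quotient.algebraMap_eq, Ideal.Quotient.algebraMap_eq,
    map_mul, hqe, Ideal.quotientEquiv_mk]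

end Semilinear

/-! ## §2 Torsion bookkeeping in short exact sequences over a Noetherian domain -/

section TorsionSES

variable {R : Type*} [CommRing R] [IsDomain R]
  {B : Type*} [AddCommGroup B] [_root_.Module R B]
  {C : Type*} [AddCommGroup C] [_root_.Module R C]

/-- An extension of a torsion module by a torsion module is torsion: if `g : B → C` is surjective
with torsion kernel and `C` is torsion then `B` is torsion (Castella–Wan, proof of Thm. 6.8: `X^{rel,str}`
is torsion from `0 → coker(loc_𝔭) → X^{rel,str} → X^{±,str} → 0`). [cite: CastellaWan2023, proof of Thm. 6.8 (MS p. 31)]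
[cite: BourbakiAC5to7, Ch. VII §4.5] -/
theorem isTorsion_of_surjective_of_ker (g : B →ₗ[R] C) (hg : Function.Surjective g)
    (hker : ∀ x ∈ LinearMap.ker g, ∃ a : R, a ≠ 0 ∧ a • x = 0) (hC : Module.IsTorsion R C) :
    Module.IsTorsion R B := by
  have _ := hg
  intro x
  obtain ⟨⟨a, ha⟩, hax⟩ := @hC (g x)
  have hmem : (a : R) • x ∈ LinearMap.ker g := by
    rw [LinearMap.mem_ker, map_smul]
    exact hax
  obtain ⟨b, hb, hbx⟩ := hker _ hmem
  refine ⟨⟨b * a, mul_mem (mem_nonZeroDivisors_of_ne_zero hb) ha⟩, ?_⟩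
  rw [Submonoid.mk_smul, mul_smul]
  exact hbx

/-- The kernel of a map with torsion kernel lies in the torsion submodule. [folklore] -/
private theorem ker_le_torsion_of_ker (g : B →ₗ[R] C)
    (hker : ∀ x ∈ LinearMap.ker g, ∃ a : R, a ≠ 0 ∧ a • x = 0) :
    LinearMap.ker g ≤ Submodule.torsion R B := by
  intro x hx
  obtain ⟨a, ha, hax⟩ := hker x hx
  exact (Submodule.mem_torsion_iff x).2 ⟨⟨a, mem_nonZeroDivisors_of_ne_zero ha⟩, hax⟩

omit [IsDomain R] in
/-- A linear map sends torsion elements to torsion elements. [folklore] -/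
private theorem map_torsion_le (g : B →ₗ[R] C) :
    (Submodule.torsion R B).map g ≤ Submodule.torsion R C := by
  rintro _ ⟨x, hx, rfl⟩
  obtain ⟨a, hax⟩ := (Submodule.mem_torsion_iff x).1 hx
  refine (Submodule.mem_torsion_iff _).2 ⟨a, ?_⟩
  rw [Submonoid.smul_def, ← map_smul, ← Submonoid.smul_def, hax, map_zero]

/-- **If `g : B ↠ C` is surjective with torsion kernel, then `g` maps `B_tors` ONTO `C_tors`**
(lift `c` with `a c = 0` to `b`; `a b ∈ ker g` is torsion, so `b` is torsion) — "taking `Λ^ac`-torsion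
in the short exact sequence `0 → coker(loc_𝔭) → X^{rel,±} → X_± → 0`" (Castella–Wan (6.15)).
[cite: CastellaWan2023, proof of Thm. 6.8, (6.15) (MS p. 31)] [cite: BourbakiAC5to7, Ch. VII §4.5] -/
theorem torsion_map_surjective_of_ker (g : B →ₗ[R] C) (hg : Function.Surjective g)
    (hker : ∀ x ∈ LinearMap.ker g, ∃ a : R, a ≠ 0 ∧ a • x = 0) :
    (Submodule.torsion R B).map g = Submodule.torsion R C := by
  refine le_antisymm (map_torsion_le g) fun c hc ↦ ?_
  obtain ⟨⟨a, ha⟩, hac⟩ := (Submodule.mem_torsion_iff c).1 hc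
  obtain ⟨b, rfl⟩ := hg c
  have hmem : (a : R) • b ∈ LinearMap.ker g := by
    rw [LinearMap.mem_ker, map_smul]
    exact hac
  obtain ⟨a', ha', hab⟩ := hker _ hmem
  refine ⟨b, (Submodule.mem_torsion_iff b).2
    ⟨⟨a' * a, mul_mem (mem_nonZeroDivisors_of_ne_zero ha') ha⟩, ?_⟩, rfl⟩
  rw [Submonoid.mk_smul, mul_smul]
  exact hab

/-- `R ⧸ I` is a torsion `R`-module as soon as the ideal `I` contains a non-zero element (`R` a
domain): `a` kills every class (Bourbaki AC VII §4.5, the cyclic torsion modules `A/𝔞`).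
[cite: BourbakiAC5to7, Ch. VII §4.5] -/
theorem isTorsion_quotient_of_ne_zero_mem {I : Ideal R} {a : R} (ha : a ≠ 0) (haI : a ∈ I) :
    Module.IsTorsion R (R ⧸ I) := by
  intro x
  obtain ⟨y, rfl⟩ := Submodule.Quotient.mk_surjective I x
  refine ⟨⟨a, mem_nonZeroDivisors_of_ne_zero ha⟩, ?_⟩
  rw [Submonoid.mk_smul, ← Submodule.Quotient.mk_smul, Submodule.Quotient.mk_eq_zero, smul_eq_mul]
  exact I.mul_mem_right y haI

variable [IsNoetherianRing R]

/-- **Ranks along a surjection with torsion kernel**: for finitely generated `B` and `g : B ↠ C`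
with torsion kernel, `rank_R B = rank_R C` (rank–nullity over a domain; a torsion module has rank
zero). E.g. `rank X^{rel,±} = rank X_±` from `0 → coker(loc_𝔭) → X^{rel,±} → X_± → 0` in
Castella–Wan's proof of Thm. 6.8. [cite: CastellaWan2023, proof of Thm. 6.8 (MS p. 30)] -/
theorem finrank_eq_of_surjective_of_ker_isTorsion [Module.Finite R B] (g : B →ₗ[R] C)
    (hg : Function.Surjective g) (hker : ∀ x ∈ LinearMap.ker g, ∃ a : R, a ≠ 0 ∧ a • x = 0) :
    Module.finrank R B = Module.finrank R C := by
  haveI : IsNoetherian R B := isNoetherian_of_isNoetherianRing_of_finite R B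
  have h1 := Submodule.finrank_quotient_add_finrank (LinearMap.ker g)
  have hker0 : Module.finrank R (LinearMap.ker g) = 0 := by
    rw [Module.finrank_eq_zero_iff_isTorsion]
    intro x
    obtain ⟨a, ha, hax⟩ := hker x x.2
    exact ⟨⟨a, mem_nonZeroDivisors_of_ne_zero ha⟩, Subtype.ext (by
      rw [Submonoid.mk_smul, Submodule.coe_smul, hax, Submodule.coe_zero])⟩
  rw [hker0, add_zero, (g.quotKerEquivOfSurjective hg).finrank_eq] at h1
  exact h1.symm

/-- **`char(B_tors) = char(ker g) · char(C_tors)`** for a surjection `g : B ↠ C` of finitely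
generated modules over a Noetherian domain whose kernel is torsion: the sequence
`0 → ker g → B_tors → C_tors → 0` is exact (`torsion_map_surjective_of_ker`) and the characteristic
ideal is multiplicative on short exact sequences of finitely generated torsion modules
(`charIdeal_eq_mul_of_exact`). This is the step "taking `Λ^ac`-torsion in the short exact sequence
`0 → coker(loc_𝔭) → X^{rel,±} → X_± → 0`" of Castella–Wan's (6.15).
[cite: CastellaWan2023, proof of Thm. 6.8, (6.15) (MS p. 31)] [cite: BourbakiAC5to7, Ch. VII §4.5 Prop. 10] -/
theorem charIdeal_torsion_eq_mul_of_surjective [Module.Finite R B] (g : B →ₗ[R] C)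
    (hg : Function.Surjective g) (hker : ∀ x ∈ LinearMap.ker g, ∃ a : R, a ≠ 0 ∧ a • x = 0) :
    charIdeal R (Submodule.torsion R B) =
      charIdeal R (LinearMap.ker g) * charIdeal R (Submodule.torsion R C) := by
  haveI : IsNoetherian R B := isNoetherian_of_isNoetherianRing_of_finite R B
  have hle : LinearMap.ker g ≤ Submodule.torsion R B := ker_le_torsion_of_ker g hker
  -- the maps of `0 → ker g → B_tors → C_tors → 0`
  let f' : LinearMap.ker g →ₗ[R] Submodule.torsion R B := Submodule.inclusion hle
  let g' : Submodule.torsion R B →ₗ[R] Submodule.torsion R C :=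
    (g.domRestrict (Submodule.torsion R B)).codRestrict (Submodule.torsion R C) fun x ↦
      map_torsion_le g ⟨x, x.2, rfl⟩
  have hf' : Function.Injective f' := Submodule.inclusion_injective hle
  have hg' : Function.Surjective g' := by
    intro c
    have hc : (c : C) ∈ (Submodule.torsion R B).map g := by
      rw [torsion_map_surjective_of_ker g hg hker]
      exact c.2
    obtain ⟨b, hb, hbc⟩ := hc
    exact ⟨⟨b, hb⟩, Subtype.ext hbc⟩
  have hex : Function.Exact f' g' := by
    intro x
    constructor
    · intro hx
      have hx' : g (x : B) = 0 := congrArg Subtype.val hx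
      exact ⟨⟨x, hx'⟩, rfl⟩
    · rintro ⟨y, rfl⟩
      exact Subtype.ext y.2
  exact charIdeal_eq_mul_of_exact (Submodule.torsion_isTorsion) f' g' hf' hg' hex

/-- **`char B = char(ker g) · char C`** for a surjection `g : B ↠ C` with `B` finitely generated
torsion (multiplicativity along `0 → ker g → B → C → 0`); e.g. Castella–Wan's
`char(X^{rel,str}) = char(X^{±,str}) · char(coker(loc_𝔭))` from (6.12).
[cite: CastellaWan2023, proof of Thm. 6.8 (MS p. 31)] [cite: BourbakiAC5to7, Ch. VII §4.5 Prop. 10] -/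
theorem charIdeal_eq_mul_of_surjective [Module.Finite R B] (hB : Module.IsTorsion R B)
    (g : B →ₗ[R] C) (hg : Function.Surjective g) :
    charIdeal R B = charIdeal R (LinearMap.ker g) * charIdeal R C :=
  charIdeal_eq_mul_of_exact hB (LinearMap.ker g).subtype g (Submodule.subtype_injective _) hg
    (LinearMap.exact_subtype_ker_map g)

omit [IsDomain R] [IsNoetherianRing R] in
/-- For a torsion module the torsion submodule is everything: `char(M_tors) = char(M)` (Castella–Wan,
proof of Thm. 6.8: "noting that `X^{±,str}` is `Λ^ac`-torsion" in (6.15)). [cite: CastellaWan2023, proof of Thm. 6.8, (6.15) (MS p. 31)]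
[cite: BourbakiAC5to7, Ch. VII §4.5] -/
theorem charIdeal_torsion_eq_of_isTorsion (hB : Module.IsTorsion R B) :
    charIdeal R (Submodule.torsion R B) = charIdeal R B := by
  have htop : Submodule.torsion R B = ⊤ := (Submodule.isTorsion'_iff_torsion'_eq_top _).1 hB
  exact Module.charIdeal_eq_of_linearEquiv
    ((LinearEquiv.ofEq _ _ htop).trans (Submodule.topEquiv))

/-- **`char(Q ⧸ P) · char(M ⧸ Q) = char(M ⧸ P)`** for submodules `P ≤ Q` of `M` with `M ⧸ P`
finitely generated torsion, where `Q ⧸ P` is written as the submodule `Q.map P.mkQ` of `M ⧸ P` and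
`(M ⧸ P) ⧸ (Q ⧸ P) ≅ M ⧸ Q` (`Submodule.quotientQuotientEquivQuotient`). E.g. Castella–Wan's (6.14):
`char(Sel/Λz) · char(coker loc_𝔭) = char(H¹_±/Λ loc_𝔭 z)`.
[cite: CastellaWan2023, proof of Thm. 6.8, (6.14) (MS p. 31)] [cite: BourbakiAC5to7, Ch. VII §4.5 Prop. 10] -/
theorem charIdeal_quotient_mul_charIdeal_quotient_map (P Q : Submodule R B) (hPQ : P ≤ Q)
    [Module.Finite R (B ⧸ P)] (hP : Module.IsTorsion R (B ⧸ P)) :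
    charIdeal R (Q.map P.mkQ) * charIdeal R (B ⧸ Q) = charIdeal R (B ⧸ P) := by
  rw [charIdeal_eq_mul_of_exact hP (Q.map P.mkQ).subtype (Q.map P.mkQ).mkQ
    (Submodule.subtype_injective _) (Submodule.mkQ_surjective _) (LinearMap.exact_subtype_mkQ _),
    Module.charIdeal_eq_of_linearEquiv (Submodule.quotientQuotientEquivQuotient P Q hPQ)]

/-- **`char(M ⧸ P) ⊆ char(M ⧸ Q)` for `P ≤ Q`** with `M ⧸ P` finitely generated torsion (the larger
quotient has the more divisible characteristic ideal: `char(M ⧸ P) = char(Q ⧸ P) · char(M ⧸ Q)`).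
E.g. `coker(loc_𝔭 | Sel^{±,rel})` is a quotient of `coker(loc_𝔭 | Sel_±)` in Castella–Wan's proof of
Thm. 6.8. [cite: CastellaWan2023, proof of Thm. 6.8 (MS pp. 30–31)] -/
theorem charIdeal_quotient_mono (P Q : Submodule R B) (hPQ : P ≤ Q)
    [Module.Finite R (B ⧸ P)] (hP : Module.IsTorsion R (B ⧸ P)) :
    charIdeal R (B ⧸ P) ≤ charIdeal R (B ⧸ Q) := by
  rw [← charIdeal_quotient_mul_charIdeal_quotient_map P Q hPQ hP]
  exact Ideal.mul_le_left

/-- **The module algebra of Castella–Wan's (6.15)–(6.16), abstractly.** Over a Noetherian domain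
let `r' : A ↠ B` and `r : C ↠ D` be surjections of finitely generated modules whose kernels are
killed by one non-zero `c` (in the application: `A = X^{rel,ε} ↠ B = X_ε` and `C = X^{rel,str} ↠
D = X^{ε,str}` with kernels the twisted cokernels of `loc_𝔭`, killed by `ι(Log loc_𝔭 z)`), with
`rank B = 1` (Howard) and Lemma 6.7 (2)'s relations `rank A = 1 + rank D`, `char(A_tors) =
char(D_tors)`. Then `D` and `C` are torsion, `rank A = 1`, and
`char(C) = char(ker r) · char(ker r') · char(B_tors)` (print: "`char(X^{rel,str}) = char(X^{±,str}) ·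
char(coker(loc_𝔭)) = char(X^±_tors) · char(coker(loc_𝔭))²`", here with the two cokernels kept
apart). [cite: CastellaWan2023, proof of Thm. 6.8, (6.15)–(6.16) (MS p. 31)] -/
theorem isTorsion_and_charIdeal_eq_of_surjective_pair
    {A : Type*} [AddCommGroup A] [_root_.Module R A] [Module.Finite R A]
    {D : Type*} [AddCommGroup D] [_root_.Module R D] [Module.Finite R D]
    [Module.Finite R B] [Module.Finite R C]
    (r' : A →ₗ[R] B) (hr' : Function.Surjective r') (r : C →ₗ[R] D) (hr : Function.Surjective r)
    (c : R) (hc : c ≠ 0) (hcA : ∀ x ∈ LinearMap.ker r', c • x = 0)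
    (hcC : ∀ x ∈ LinearMap.ker r, c • x = 0) (hB : Module.finrank R B = 1)
    (h67a : Module.finrank R A = 1 + Module.finrank R D)
    (h67b : charIdeal R (Submodule.torsion R A) = charIdeal R (Submodule.torsion R D)) :
    Module.IsTorsion R C ∧ Module.IsTorsion R D ∧ Module.finrank R A = 1 ∧
      charIdeal R C = charIdeal R (LinearMap.ker r) *
        (charIdeal R (LinearMap.ker r') * charIdeal R (Submodule.torsion R B)) := by
  have hkA : ∀ x ∈ LinearMap.ker r', ∃ a : R, a ≠ 0 ∧ a • x = 0 := fun x hx ↦ ⟨c, hc, hcA x hx⟩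
  have hkC : ∀ x ∈ LinearMap.ker r, ∃ a : R, a ≠ 0 ∧ a • x = 0 := fun x hx ↦ ⟨c, hc, hcC x hx⟩
  -- ranks: `rank A = rank B = 1`, so `rank D = 0` and `D` is torsion
  have hA : Module.finrank R A = 1 := by
    rw [finrank_eq_of_surjective_of_ker_isTorsion r' hr' hkA, hB]
  have hD0 : Module.finrank R D = 0 := by omega
  have hD : Module.IsTorsion R D := Module.finrank_eq_zero_iff_isTorsion.1 hD0
  -- (6.15) on torsion parts, and Lemma 6.7 (2)
  have h615 := charIdeal_torsion_eq_mul_of_surjective r' hr' hkA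
  have h67b' : charIdeal R (Submodule.torsion R A) = charIdeal R D := by
    rw [h67b, charIdeal_torsion_eq_of_isTorsion hD]
  -- (6.16): `C` is torsion and `char C = char(ker r) · char D`
  have hC : Module.IsTorsion R C := isTorsion_of_surjective_of_ker r hr hkC hD
  have h616 := charIdeal_eq_mul_of_surjective hC r hr
  refine ⟨hC, hD, hA, ?_⟩
  rw [h616, ← h67b', h615]

end TorsionSES

end Module

end Literature.NumberTheory.EllipticCurves

end
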